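import Summits.ABC.IUTFork.Repair.CandDupuyHilado13
import Summits.ABC.IUTFork.Repair.CandInternal11GapLabelCut
import Summits.ABC.IUTFork.Repair.ObstructionSS28Budget
import HarnessLib

/-!
# IUT REPAIR branch → R-H (D-0079 «local-height» programme): the C1 LABEL-CUT k2 DOOR AT THE GENUINE BED
# `Thm311.Real.settingPrVolSharp X …` (in particular `X = Cor312Prov.pilotDataOfK D K`), PIN-FREE — part 1: the cut door and the NUMBERS door

PROOF-ONLY file (D-0012: 0 definitions, 0 `Prop` facts; abc-iut cell, rung LADDER-ABC:A2.B ⊇ A2.RP → A2.RESCUE-H; seat abc-iut-rp-h1 gen 12, R-H k2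
hand #7; abc-iut-rh-lead «GO rp-h1 C1 LABEL-CUT k2 TEMPLATE» 2026-08-26T15:23:52Z: «instantiate rp-h3's `CandInternal11GapWindow.licence_of_starOn` +
rp-s2's `ObstructionSS28Window.statement_of_starOn_of_budget` at `settingPrVolSharp (pilotDataOfK …)` so that a C1 candidate «I06⋆ at j ≤ j₀(w)»
supplies ONLY j₀ and the budget numbers»). TAKES NO SIDE on [IUTchIII] Cor. 3.12 or on any author; candidates are hypotheses; typed ≠ proved;
instantiated ≠ endorsed; DEFS-FREEZE respected (everything consumed BY NAME: abc-iut-rp-h3 `CandInternal11GapLabelCut` p455703, abc-iut-rp-s2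
`ObstructionSS28Window` p451819 / `ObstructionSS28Budget` p453881, abc-iut-c312-7 `Cor312PilotIdelesPrCapstone` (`bridgeHyps_settingPrVolSharp_of_ideles`,
`thetaFinite_settingPrVolSharp`), abc-iut-C-cert-1 / this lineage `PinnedHonestReal.scaled_settingPrVolSharp` p430714). Inputs ⊆ the frozen FACT-LIST;
standard axioms. Part 2 (`RHLabelCutGenuineFloor`): the constant-cut floor mass as a NUMBER of the datum and the honest verdict lemma.

THE BED. abc-iut-c312-7's print-normalised assembled real setting `settingPrVolSharp X hlog M archPk archSub Ψ act Mmod region n lat sig split qData tq t …`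
over abc-iut-c312-5's real lattice situation on Dupuy–Hilado's log-shells `logShellsDH X logv` ([cite: DupuyHilado2025, §3.3, (3.4), Thm 3.10.1, §4.9–§4.12]),
for ANY pilot datum `X : PilotData F` (in particular the GENUINE `K`-level datum `Cor312Prov.pilotDataOfK D K` of a collection of initial Θ-data,
[IUTchI] Def. 3.1) with Θ- and q-ideles `t`, `tq` REALISING `P_Θ`, `P_q` (closed-form hypotheses `ht`, `htq`; inhabited by abc-iut-c312-3's
`exists_realising_thetaIdeles` / `_qIdeles`). Every column / context / archimedean binder is FREE; the interface lemmas are applied with the line's coric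
column data (the Statement reads no column datum, as in `CandDupuyHilado15`). Cell slack (abc-iut-rp-s2's σ, never defined):
`σ_{i+1,v_ℚ} := logvol(ⁿ˒°𝒰_{i+1,v_ℚ}) − qLocal_{i+1,v_ℚ}`; floor `((i+1)² − 1)·(−qLocal_{i+1,v_ℚ})`; cut `j₀ : V_ℚ → ℕ` (abc-iut-rp-h3's place-dependent phrasing).

WHAT THIS FILE PROVES (namespace `Summit.ABC.IUTFork.Repair.RHLabelCutGenuine`).
* §0 the bed's bridge hypotheses / `ThetaFinite` for realising ideles, by name (abc-iut-c312-7).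
* §1 **`cellSlack_ge_neg_floor_settingPrVolSharp`** — PIN-FREE: at EVERY cell the deficit never exceeds the floor, from honest `j²`-scaling (a THEOREM of
  the bed) and «the hull contains the (Ind3)-region» (bridge hypotheses of the bed) — abc-iut-rp-s2's `ObstructionSS28Budget.cellSlack_ge_neg_floor_at`
  WITHOUT its Θ-pin / (ii)(b) / `hscaled` hypotheses, which are not theorems at genuine data.
* §2 THE CUT DOOR AT THE BED: `statement_settingPrVolSharp_iff_cut_budget` (`Statement ↔ 0 ≤ PN(below-cut Σᶠ σ) + PN(above-cut Σᶠ σ)`, no hypothesis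
  beyond the realising ideles); `statement_settingPrVolSharp_of_licenceBelow_of_budget` / `…_iff_budget_of_licenceBelow` (abc-iut-rp-h3's `ρ`-free §3 with
  the bed's bridge hypotheses DISCHARGED); **`aboveCut_deficit_le_floorMass_settingPrVolSharp`** (PIN-FREE: `−PN(above Σᶠ σ) ≤ PN(above Σᶠ floor)`); the
  WORST-CASE door `statement_settingPrVolSharp_of_licenceBelow_of_surplus_ge_floorMass`; and the NUMBERS door
  **`statement_settingPrVolSharp_of_surplusBelow_ge_floorMass`**: finitely supported below-cut surplus bounds `s_{i,v_ℚ} ≤ σ_{i+1,v_ℚ}` with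
  `PN(above Σᶠ floor) ≤ PN(below Σᶠ s)` give the typed Statement — NO licence / I06⋆ hypothesis at all (the below-cut cells only SOURCE the numbers `s`:
  a licence / I06⋆ cell signs `s = 0`, a reach or hull-volume theorem gives a positive `s`).
HONEST SCOPE. Bookkeeping at the genuine bed; nothing here decides a below-cut cell or a surplus number at genuine data (the deciders are abc-iut-rp-d2's
`CandInternal2RealLabels/Strata`, abc-iut-rp-h3's `CandInternal11GapGenuineTame`, abc-iut-w5-d068's RH-TAME-JOIN, branch C's reach theorems and the
I06STAR-COLUMNS / WINDOW-TABLE). [claim: Mochizuki2012, status: disputed] for every [IUTchIII]/[IUTchIV] locution; [cite: ScholzeStix2018, §2.2 pp. 9–10];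
[cite: DupuyHilado2025, §3.3, (3.4), Thm 3.10.1]. Axioms: standard.
-/

noncomputable section

open Set Function NumberField IsDedekindDomain

namespace Summit.ABC.IUTFork.Repair.RHLabelCutGenuine

open Thm311 Thm311.Real Cor312 Cor312Vol Literature.IUT.LogThetaLattice Literature.IUT.LogVolume Literature.IUT.HodgeTheaters
open Summit.ABC.IUTFork.Repair.ObstructionSS28Window Summit.ABC.IUTFork.Repair.ObstructionSS28Budget
open Summit.ABC.IUTFork.Repair.CandInternal11GapLabelCut
open Repair.CandDupuyHilado13 (ndeg_qPilot_pos qLocal_indep_settingPrVolSharp)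

variable {F : Type} [Field F] [NumberField F] (X : PilotData F) {logv : PadicLogs F} (hlog : LogvAnalytic logv)
  (M : Type) [Field M] [NumberField M]
  (archPk : ∀ (j : (thetaIndex X).Label) (vQ : (thetaIndex X).VQ), Set ((logShellsDH X logv).Packet j vQ))
  (archSub : ∀ (j : (thetaIndex X).Label) (v : (thetaIndex X).V),
    Set ((logShellsDH X logv).Packet j ((thetaIndex X).over v)))
  (Ψ : ℤ → ∀ v : (thetaIndex X).V, v ∈ (thetaIndex X).Vbad → Set ((logShellsDH X logv).StarPacket v))
  (act : ℤ → ∀ v : (thetaIndex X).V, v ∈ (thetaIndex X).Vbad →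
    (logShellsDH X logv).StarPacket v → Module.End ℚ ((logShellsDH X logv).StarPacket v))
  (Mmod : ℤ → ∀ j : (thetaIndex X).LabelStar, Set ((logShellsDH X logv).GlobalPacket j.1))
  (region : ℤ → ∀ j : (thetaIndex X).LabelStar, FinDivisor M → ∀ vQ : (thetaIndex X).VQ,
    Set ((logShellsDH X logv).Packet j.1 vQ))
  (n : ℤ) {HT : Type} {LogLink : HT → HT → Type} {IsFull : ∀ {s t : HT}, LogLink s t → Prop}
  (lat : LGPGaussianLogThetaLattice LogLink IsFull)
  {Frd : Type} {IsoF : Frd → Frd → Type} {Ob : Frd → Type} {realify : Frd → Frd} {Strip : Type}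
  {IsoS : Strip → Strip → Type} {Mv : ∀ v : (thetaIndex X).V, v ∈ (thetaIndex X).Vbad → Type}
  [∀ v h, Monoid (Mv v h)]
  (sig : GlobalLGPFrobenioidSignature (thetaIndex X).lstar (thetaIndex X).V (· ∈ (thetaIndex X).Vbad)
    Frd IsoF Ob realify Strip IsoS Mv)
  (split : SplittingMonoids Mv) {ObΔ : Type} {N : ∀ v : (thetaIndex X).V, v ∈ (thetaIndex X).Vbad → Type}
  [∀ v h, Monoid (N v h)] (qData : QPilotData ObΔ N)
  (t : ∀ (pp : Nat.Primes) (_ : Fin X.lstar) (x : (thetaIndex X).Fibre (.inr pp)),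
    haveI : Fact (pp : ℕ).Prime := ⟨pp.2⟩; kOf X pp.1 x)
  (tq : ∀ (pp : Nat.Primes) (x : (thetaIndex X).Fibre (.inr pp)), haveI : Fact (pp : ℕ).Prime := ⟨pp.2⟩; kOf X pp.1 x)
  (ht0 : ∀ pp i x, t pp i x ≠ 0)
  /- the Θ-ideles REALISE `P_Θ` in Dupuy–Hilado's normalisation (3.4) -/
  (ht : ∀ (pp : Nat.Primes) (i : Fin X.lstar) (x : (thetaIndex X).Fibre (.inr pp)),
    haveI : Fact (pp : ℕ).Prime := ⟨pp.2⟩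
    Real.log ‖t pp i x‖ = -(X.thetaPilot i (placeOf X pp.1 x)) * logNorm F (placeOf X pp.1 x) / localDegree F (placeOf X pp.1 x))
  (htq0 : ∀ pp x, tq pp x ≠ 0)
  (htq1 : ∀ (pp : Nat.Primes) (x : (thetaIndex X).Fibre (.inr pp)),
    haveI : Fact (pp : ℕ).Prime := ⟨pp.2⟩; placeOf X pp.1 x ∉ X.S → ‖tq pp x‖ = 1)
  /- the q-ideles REALISE `P_q` -/
  (htq : ∀ (pp : Nat.Primes) (x : (thetaIndex X).Fibre (.inr pp)),
    haveI : Fact (pp : ℕ).Prime := ⟨pp.2⟩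
    Real.log ‖tq pp x‖ = -(X.qPilot (placeOf X pp.1 x)) * logNorm F (placeOf X pp.1 x) / localDegree F (placeOf X pp.1 x))

/-! ## §0. The bed's bridge hypotheses and `ThetaFinite`, for realising ideles (abc-iut-c312-7, by name) -/

include ht0 ht in
/-- Θ-ideles realising `P_Θ` are units off `S` (abc-iut-c312-3 `norm_eq_one_of_realises`). [cite: DupuyHilado2025, (3.4)] -/
theorem thetaIdeles_units_off_S : ∀ (pp : Nat.Primes) (i : Fin X.lstar) (x : (thetaIndex X).Fibre (.inr pp)),
    haveI : Fact (pp : ℕ).Prime := ⟨pp.2⟩; placeOf X pp.1 x ∉ X.S → ‖t pp i x‖ = 1 :=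
  fun pp i x hx => norm_eq_one_of_realises X t ht0 ht pp i x hx

include ht0 ht in
/-- **The bridge hypotheses of abc-iut-c312-6 HOLD at the bed** (`bridgeHyps_settingPrVolSharp_of_ideles`). [claim: Mochizuki2012, status: disputed] -/
theorem bridgeHyps : BridgeHyps (settingPrVolSharp X hlog M archPk archSub Ψ act Mmod region n lat sig split qData tq t htq0 htq1) :=
  bridgeHyps_settingPrVolSharp_of_ideles X hlog M archPk archSub Ψ act Mmod region n lat sig split qData t tq ht0
    (thetaIdeles_units_off_S X t ht0 ht) htq0 htq1

include ht0 ht in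
/-- `−|log(Θ)| ∈ ℝ` at the bed (`thetaFinite_settingPrVolSharp`). [claim: Mochizuki2012, status: disputed] -/
theorem thetaFinite : (settingPrVolSharp X hlog M archPk archSub Ψ act Mmod region n lat sig split qData tq t htq0 htq1).ThetaFinite :=
  thetaFinite_settingPrVolSharp X hlog M archPk archSub Ψ act Mmod region n lat sig split qData t tq ht0
    (thetaIdeles_units_off_S X t ht0 ht) htq0 htq1

/-! ## §1. Pin-free cell facts at the bed -/

include ht0 ht htq in
/-- **AT THE GENUINE BED A CELL'S DEFICIT NEVER EXCEEDS ITS FLOOR — PIN-FREE.** At every cell `(i+1, v_ℚ)`: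
`−(((i+1)² − 1)·(−qLocal)) ≤ logvol(ⁿ˒°𝒰) − qLocal`, because the hull contains the (Ind3)-region (bridge hypotheses of the bed) whose volume IS
`(i+1)²·qLocal` (honest `j²`-scaling, a THEOREM of the bed: `PinnedHonestReal.scaled_settingPrVolSharp`). No Θ-pin, no (ii)(b), no candidate.
[cite: DupuyHilado2025, §3.3, Thm 3.10.1] [claim: Mochizuki2012, status: disputed] -/
theorem cellSlack_ge_neg_floor_settingPrVolSharp (i : Fin (thetaIndex X).lstar) (vQ : (thetaIndex X).VQ) :
    -(((((i : ℕ) + 1 : ℕ) : ℝ) ^ 2 - 1) *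
        (-(settingPrVolSharp X hlog M archPk archSub Ψ act Mmod region n lat sig split qData tq t htq0 htq1).qLocal
          (Setting.labelSucc i) vQ)) ≤
      ((situationPrVol X hlog M archPk archSub Ψ act Mmod region).D n).logvol _ vQ
          ((settingPrVolSharp X hlog M archPk archSub Ψ act Mmod region n lat sig split qData tq t htq0 htq1).thetaHull
            (Setting.labelSucc i) vQ) -
        (settingPrVolSharp X hlog M archPk archSub Ψ act Mmod region n lat sig split qData tq t htq0 htq1).qLocal
          (Setting.labelSucc i) vQ := by
  have h := ObstructionSS28Budget.logvol_thetaRegion3_le_logvol_thetaHull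
    (LatticeSituation.ofShells (logShellsDH X logv) M archPk archSub (summandPiecesPr X hlog).Adm (summandPiecesPr X hlog).logvol Ψ act
      Mmod region (fun _ _ => (summandPiecesPr X hlog).Adm) (fun _ _ => (summandPiecesPr X hlog).logvol) (fun k _ => Ψ k)
      (fun k _ => Mmod k) (fun _ _ _ _ _ => ∅) (fun _ _ _ _ => ∅) (fun _ _ _ => 0))
    (settingPrVolSharp X hlog M archPk archSub Ψ act Mmod region n lat sig split qData tq t htq0 htq1)
    (bridgeHyps X hlog M archPk archSub Ψ act Mmod region n lat sig split qData t tq ht0 ht htq0 htq1) i vQ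
  have h' : ((situationPrVol X hlog M archPk archSub Ψ act Mmod region).D n).logvol _ vQ
        ((settingPrVolSharp X hlog M archPk archSub Ψ act Mmod region n lat sig split qData tq t htq0 htq1).thetaRegion3
          (Setting.labelSucc i) vQ) ≤
      ((situationPrVol X hlog M archPk archSub Ψ act Mmod region).D n).logvol _ vQ
        ((settingPrVolSharp X hlog M archPk archSub Ψ act Mmod region n lat sig split qData tq t htq0 htq1).thetaHull
          (Setting.labelSucc i) vQ) := h
  have hs := PinnedHonestReal.scaled_settingPrVolSharp X hlog M archPk archSub Ψ act Mmod region n lat sig split qData t tq ht0 ht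
    htq0 htq1 htq i vQ
  rw [hs] at h'
  linarith

/-! ## §2. The cut door at the bed (place-dependent cut `j₀ : V_ℚ → ℕ`) -/

section Cut

variable (j₀ : (thetaIndex X).VQ → ℕ)

include ht0 ht in
/-- **CUT BUDGET AT THE BED** (no hypothesis beyond the realising ideles): `Statement ↔ 0 ≤ PN(below-cut Σᶠ σ) + PN(above-cut Σᶠ σ)` —
abc-iut-rp-h3's `statement_iff_cut_budget` with `ThetaFinite` discharged. [claim: Mochizuki2012, status: disputed] -/
theorem statement_settingPrVolSharp_iff_cut_budget :
    (settingPrVolSharp X hlog M archPk archSub Ψ act Mmod region n lat sig split qData tq t htq0 htq1).Statement ↔ 0 ≤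
      processionNormalized (fun i : Fin (thetaIndex X).lstar => ∑ᶠ vQ ∈ {vQ : (thetaIndex X).VQ | (i : ℕ) + 1 ≤ j₀ vQ},
          (((situationPrVol X hlog M archPk archSub Ψ act Mmod region).D n).logvol _ vQ
              ((settingPrVolSharp X hlog M archPk archSub Ψ act Mmod region n lat sig split qData tq t htq0 htq1).thetaHull
                (Setting.labelSucc i) vQ) -
            (settingPrVolSharp X hlog M archPk archSub Ψ act Mmod region n lat sig split qData tq t htq0 htq1).qLocal
              (Setting.labelSucc i) vQ)) +
        processionNormalized (fun i : Fin (thetaIndex X).lstar => ∑ᶠ vQ ∈ {vQ : (thetaIndex X).VQ | j₀ vQ < (i : ℕ) + 1},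
          (((situationPrVol X hlog M archPk archSub Ψ act Mmod region).D n).logvol _ vQ
              ((settingPrVolSharp X hlog M archPk archSub Ψ act Mmod region n lat sig split qData tq t htq0 htq1).thetaHull
                (Setting.labelSucc i) vQ) -
            (settingPrVolSharp X hlog M archPk archSub Ψ act Mmod region n lat sig split qData tq t htq0 htq1).qLocal
              (Setting.labelSucc i) vQ)) :=
  CandInternal11GapLabelCut.statement_iff_cut_budget
    (LatticeSituation.ofShells (logShellsDH X logv) M archPk archSub (summandPiecesPr X hlog).Adm (summandPiecesPr X hlog).logvol Ψ act
      Mmod region (fun _ _ => (summandPiecesPr X hlog).Adm) (fun _ _ => (summandPiecesPr X hlog).logvol) (fun k _ => Ψ k)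
      (fun k _ => Mmod k) (fun _ _ _ _ _ => ∅) (fun _ _ _ _ => ∅) (fun _ _ _ => 0))
    (settingPrVolSharp X hlog M archPk archSub Ψ act Mmod region n lat sig split qData tq t htq0 htq1) j₀
    (thetaFinite X hlog M archPk archSub Ψ act Mmod region n lat sig split qData t tq ht0 ht htq0 htq1)

include ht0 ht in
/-- **LICENCE CELLS BELOW THE CUT + THE ABOVE-CUT BUDGET ⟹ THE TYPED COROLLARY AT THE BED** (abc-iut-rp-h3's `ρ`-free door
`statement_of_licenceBelow_of_budget` with the bed's bridge hypotheses discharged; the below-cut licence cells are whatever the stratum deciders supply).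
[claim: Mochizuki2012, status: disputed] -/
theorem statement_settingPrVolSharp_of_licenceBelow_of_budget
    (hbelow : ∀ (i : Fin (thetaIndex X).lstar) (vQ : (thetaIndex X).VQ), (i : ℕ) + 1 ≤ j₀ vQ →
      (settingPrVolSharp X hlog M archPk archSub Ψ act Mmod region n lat sig split qData tq t htq0 htq1).qRegion (Setting.labelSucc i) vQ ⊆
        (settingPrVolSharp X hlog M archPk archSub Ψ act Mmod region n lat sig split qData tq t htq0 htq1).thetaHull (Setting.labelSucc i) vQ)
    (hbudget : -processionNormalized (fun i : Fin (thetaIndex X).lstar => ∑ᶠ vQ ∈ {vQ : (thetaIndex X).VQ | j₀ vQ < (i : ℕ) + 1},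
          (((situationPrVol X hlog M archPk archSub Ψ act Mmod region).D n).logvol _ vQ
              ((settingPrVolSharp X hlog M archPk archSub Ψ act Mmod region n lat sig split qData tq t htq0 htq1).thetaHull
                (Setting.labelSucc i) vQ) -
            (settingPrVolSharp X hlog M archPk archSub Ψ act Mmod region n lat sig split qData tq t htq0 htq1).qLocal
              (Setting.labelSucc i) vQ)) ≤
      processionNormalized (fun i : Fin (thetaIndex X).lstar => ∑ᶠ vQ ∈ {vQ : (thetaIndex X).VQ | (i : ℕ) + 1 ≤ j₀ vQ},
          (((situationPrVol X hlog M archPk archSub Ψ act Mmod region).D n).logvol _ vQ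
              ((settingPrVolSharp X hlog M archPk archSub Ψ act Mmod region n lat sig split qData tq t htq0 htq1).thetaHull
                (Setting.labelSucc i) vQ) -
            (settingPrVolSharp X hlog M archPk archSub Ψ act Mmod region n lat sig split qData tq t htq0 htq1).qLocal
              (Setting.labelSucc i) vQ))) :
    (settingPrVolSharp X hlog M archPk archSub Ψ act Mmod region n lat sig split qData tq t htq0 htq1).Statement :=
  CandInternal11GapLabelCut.statement_of_licenceBelow_of_budget
    (LatticeSituation.ofShells (logShellsDH X logv) M archPk archSub (summandPiecesPr X hlog).Adm (summandPiecesPr X hlog).logvol Ψ act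
      Mmod region (fun _ _ => (summandPiecesPr X hlog).Adm) (fun _ _ => (summandPiecesPr X hlog).logvol) (fun k _ => Ψ k)
      (fun k _ => Mmod k) (fun _ _ _ _ _ => ∅) (fun _ _ _ _ => ∅) (fun _ _ _ => 0))
    (settingPrVolSharp X hlog M archPk archSub Ψ act Mmod region n lat sig split qData tq t htq0 htq1) j₀
    (bridgeHyps X hlog M archPk archSub Ψ act Mmod region n lat sig split qData t tq ht0 ht htq0 htq1) hbelow hbudget

include ht0 ht in
/-- **With licence cells below the cut, the above-cut budget IS the Corollary at the bed.** [claim: Mochizuki2012, status: disputed] -/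
theorem statement_settingPrVolSharp_iff_budget_of_licenceBelow
    (hbelow : ∀ (i : Fin (thetaIndex X).lstar) (vQ : (thetaIndex X).VQ), (i : ℕ) + 1 ≤ j₀ vQ →
      (settingPrVolSharp X hlog M archPk archSub Ψ act Mmod region n lat sig split qData tq t htq0 htq1).qRegion (Setting.labelSucc i) vQ ⊆
        (settingPrVolSharp X hlog M archPk archSub Ψ act Mmod region n lat sig split qData tq t htq0 htq1).thetaHull (Setting.labelSucc i) vQ) :
    (settingPrVolSharp X hlog M archPk archSub Ψ act Mmod region n lat sig split qData tq t htq0 htq1).Statement ↔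
      -processionNormalized (fun i : Fin (thetaIndex X).lstar => ∑ᶠ vQ ∈ {vQ : (thetaIndex X).VQ | j₀ vQ < (i : ℕ) + 1},
            (((situationPrVol X hlog M archPk archSub Ψ act Mmod region).D n).logvol _ vQ
                ((settingPrVolSharp X hlog M archPk archSub Ψ act Mmod region n lat sig split qData tq t htq0 htq1).thetaHull
                  (Setting.labelSucc i) vQ) -
              (settingPrVolSharp X hlog M archPk archSub Ψ act Mmod region n lat sig split qData tq t htq0 htq1).qLocal
                (Setting.labelSucc i) vQ)) ≤
        processionNormalized (fun i : Fin (thetaIndex X).lstar => ∑ᶠ vQ ∈ {vQ : (thetaIndex X).VQ | (i : ℕ) + 1 ≤ j₀ vQ},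
            (((situationPrVol X hlog M archPk archSub Ψ act Mmod region).D n).logvol _ vQ
                ((settingPrVolSharp X hlog M archPk archSub Ψ act Mmod region n lat sig split qData tq t htq0 htq1).thetaHull
                  (Setting.labelSucc i) vQ) -
              (settingPrVolSharp X hlog M archPk archSub Ψ act Mmod region n lat sig split qData tq t htq0 htq1).qLocal
                (Setting.labelSucc i) vQ)) :=
  CandInternal11GapLabelCut.statement_iff_budget_of_licenceBelow
    (LatticeSituation.ofShells (logShellsDH X logv) M archPk archSub (summandPiecesPr X hlog).Adm (summandPiecesPr X hlog).logvol Ψ act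
      Mmod region (fun _ _ => (summandPiecesPr X hlog).Adm) (fun _ _ => (summandPiecesPr X hlog).logvol) (fun k _ => Ψ k)
      (fun k _ => Mmod k) (fun _ _ _ _ _ => ∅) (fun _ _ _ _ => ∅) (fun _ _ _ => 0))
    (settingPrVolSharp X hlog M archPk archSub Ψ act Mmod region n lat sig split qData tq t htq0 htq1) j₀
    (bridgeHyps X hlog M archPk archSub Ψ act Mmod region n lat sig split qData t tq ht0 ht htq0 htq1) hbelow

include ht0 ht htq in
/-- Label by label ABOVE the cut, at the bed, the slack sum is at least minus the floor sum — PIN-FREE (§1 pointwise; finite supports from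
Prop. 3.9 (iii) and `ThetaFinite`; indicator bookkeeping as in abc-iut-rp-s2's `finsum_offWindow_floor_add_cellSlack_nonneg`). [claim: Mochizuki2012, status: disputed] -/
theorem finsum_aboveCut_floor_add_cellSlack_nonneg_settingPrVolSharp (i : Fin (thetaIndex X).lstar) :
    0 ≤ (∑ᶠ vQ ∈ {vQ : (thetaIndex X).VQ | j₀ vQ < (i : ℕ) + 1}, ((((i : ℕ) + 1 : ℕ) : ℝ) ^ 2 - 1) *
          (-(settingPrVolSharp X hlog M archPk archSub Ψ act Mmod region n lat sig split qData tq t htq0 htq1).qLocal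
            (Setting.labelSucc i) vQ)) +
      ∑ᶠ vQ ∈ {vQ : (thetaIndex X).VQ | j₀ vQ < (i : ℕ) + 1},
          (((situationPrVol X hlog M archPk archSub Ψ act Mmod region).D n).logvol _ vQ
              ((settingPrVolSharp X hlog M archPk archSub Ψ act Mmod region n lat sig split qData tq t htq0 htq1).thetaHull
                (Setting.labelSucc i) vQ) -
            (settingPrVolSharp X hlog M archPk archSub Ψ act Mmod region n lat sig split qData tq t htq0 htq1).qLocal
              (Setting.labelSucc i) vQ) := by
  have hfin := thetaFinite X hlog M archPk archSub Ψ act Mmod region n lat sig split qData t tq ht0 ht htq0 htq1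
  have hf : (Function.support ({vQ : (thetaIndex X).VQ | j₀ vQ < (i : ℕ) + 1}.indicator fun vQ : (thetaIndex X).VQ =>
      ((((i : ℕ) + 1 : ℕ) : ℝ) ^ 2 - 1) *
        (-(settingPrVolSharp X hlog M archPk archSub Ψ act Mmod region n lat sig split qData tq t htq0 htq1).qLocal
          (Setting.labelSucc i) vQ))).Finite := by
    rw [Set.support_indicator]
    exact (ObstructionSS28Budget.floor_support_finite
      (LatticeSituation.ofShells (logShellsDH X logv) M archPk archSub (summandPiecesPr X hlog).Adm (summandPiecesPr X hlog).logvol Ψ act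
        Mmod region (fun _ _ => (summandPiecesPr X hlog).Adm) (fun _ _ => (summandPiecesPr X hlog).logvol) (fun k _ => Ψ k)
        (fun k _ => Mmod k) (fun _ _ _ _ _ => ∅) (fun _ _ _ _ => ∅) (fun _ _ _ => 0))
      (settingPrVolSharp X hlog M archPk archSub Ψ act Mmod region n lat sig split qData tq t htq0 htq1) i).inter_of_right _
  have hg : (Function.support ({vQ : (thetaIndex X).VQ | j₀ vQ < (i : ℕ) + 1}.indicator fun vQ : (thetaIndex X).VQ =>
      ((situationPrVol X hlog M archPk archSub Ψ act Mmod region).D n).logvol _ vQ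
          ((settingPrVolSharp X hlog M archPk archSub Ψ act Mmod region n lat sig split qData tq t htq0 htq1).thetaHull
            (Setting.labelSucc i) vQ) -
        (settingPrVolSharp X hlog M archPk archSub Ψ act Mmod region n lat sig split qData tq t htq0 htq1).qLocal
          (Setting.labelSucc i) vQ)).Finite := by
    rw [Set.support_indicator]
    exact (ObstructionSS28Window.cellSlack_support_finite
      (LatticeSituation.ofShells (logShellsDH X logv) M archPk archSub (summandPiecesPr X hlog).Adm (summandPiecesPr X hlog).logvol Ψ act
        Mmod region (fun _ _ => (summandPiecesPr X hlog).Adm) (fun _ _ => (summandPiecesPr X hlog).logvol) (fun k _ => Ψ k)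
        (fun k _ => Mmod k) (fun _ _ _ _ _ => ∅) (fun _ _ _ _ => ∅) (fun _ _ _ => 0))
      (settingPrVolSharp X hlog M archPk archSub Ψ act Mmod region n lat sig split qData tq t htq0 htq1) hfin i).inter_of_right _
  rw [finsum_mem_def, finsum_mem_def, ← finsum_add_distrib hf hg]
  refine finsum_nonneg fun vQ => ?_
  by_cases hW : j₀ vQ < (i : ℕ) + 1
  · have hm : vQ ∈ {vQ : (thetaIndex X).VQ | j₀ vQ < (i : ℕ) + 1} := hW
    simp only [Set.indicator_of_mem hm]
    have h := cellSlack_ge_neg_floor_settingPrVolSharp X hlog M archPk archSub Ψ act Mmod region n lat sig split qData t tq ht0 ht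
      htq0 htq1 htq i vQ
    linarith
  · have hn : vQ ∉ {vQ : (thetaIndex X).VQ | j₀ vQ < (i : ℕ) + 1} := hW
    simp only [Set.indicator_of_notMem hn, add_zero, le_refl]

include ht0 ht htq in
/-- **ABOVE THE CUT: DEFICIT ≤ FLOOR MASS — PIN-FREE AT THE BED.** `−PN(i ↦ Σᶠ_{v_ℚ : j₀(v_ℚ) < i+1} σ) ≤ PN(i ↦ Σᶠ_{v_ℚ : j₀(v_ℚ) < i+1} ((i+1)² − 1)·(−qLocal))`:
nothing about the hull above the cut is used beyond «it contains the (Ind3)-region». [claim: Mochizuki2012, status: disputed] -/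
theorem aboveCut_deficit_le_floorMass_settingPrVolSharp :
    -processionNormalized (fun i : Fin (thetaIndex X).lstar => ∑ᶠ vQ ∈ {vQ : (thetaIndex X).VQ | j₀ vQ < (i : ℕ) + 1},
          (((situationPrVol X hlog M archPk archSub Ψ act Mmod region).D n).logvol _ vQ
              ((settingPrVolSharp X hlog M archPk archSub Ψ act Mmod region n lat sig split qData tq t htq0 htq1).thetaHull
                (Setting.labelSucc i) vQ) -
            (settingPrVolSharp X hlog M archPk archSub Ψ act Mmod region n lat sig split qData tq t htq0 htq1).qLocal
              (Setting.labelSucc i) vQ)) ≤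
      processionNormalized (fun i : Fin (thetaIndex X).lstar => ∑ᶠ vQ ∈ {vQ : (thetaIndex X).VQ | j₀ vQ < (i : ℕ) + 1},
          ((((i : ℕ) + 1 : ℕ) : ℝ) ^ 2 - 1) *
            (-(settingPrVolSharp X hlog M archPk archSub Ψ act Mmod region n lat sig split qData tq t htq0 htq1).qLocal
              (Setting.labelSucc i) vQ)) := by
  have hsum : 0 ≤ processionNormalized (fun i : Fin (thetaIndex X).lstar => ∑ᶠ vQ ∈ {vQ : (thetaIndex X).VQ | j₀ vQ < (i : ℕ) + 1},
          ((((i : ℕ) + 1 : ℕ) : ℝ) ^ 2 - 1) *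
            (-(settingPrVolSharp X hlog M archPk archSub Ψ act Mmod region n lat sig split qData tq t htq0 htq1).qLocal
              (Setting.labelSucc i) vQ)) +
      processionNormalized (fun i : Fin (thetaIndex X).lstar => ∑ᶠ vQ ∈ {vQ : (thetaIndex X).VQ | j₀ vQ < (i : ℕ) + 1},
          (((situationPrVol X hlog M archPk archSub Ψ act Mmod region).D n).logvol _ vQ
              ((settingPrVolSharp X hlog M archPk archSub Ψ act Mmod region n lat sig split qData tq t htq0 htq1).thetaHull
                (Setting.labelSucc i) vQ) -
            (settingPrVolSharp X hlog M archPk archSub Ψ act Mmod region n lat sig split qData tq t htq0 htq1).qLocal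
              (Setting.labelSucc i) vQ)) := by
    unfold processionNormalized
    rw [← add_div, ← Finset.sum_add_distrib]
    exact div_nonneg (Finset.sum_nonneg fun i _ =>
      finsum_aboveCut_floor_add_cellSlack_nonneg_settingPrVolSharp X hlog M archPk archSub Ψ act Mmod region n lat sig split qData t tq
        ht0 ht htq0 htq1 htq j₀ i) (Nat.cast_nonneg _)
  linarith

include ht0 ht htq in
/-- **WORST-CASE DOOR AT THE BED.** Licence cells below the cut and «below-cut surplus ≥ above-cut FLOOR MASS»
(`PN(above Σᶠ floor) ≤ PN(below Σᶠ σ)`) give the typed Statement — PIN-FREE, nothing about the hull above the cut.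
[claim: Mochizuki2012, status: disputed] -/
theorem statement_settingPrVolSharp_of_licenceBelow_of_surplus_ge_floorMass
    (hbelow : ∀ (i : Fin (thetaIndex X).lstar) (vQ : (thetaIndex X).VQ), (i : ℕ) + 1 ≤ j₀ vQ →
      (settingPrVolSharp X hlog M archPk archSub Ψ act Mmod region n lat sig split qData tq t htq0 htq1).qRegion (Setting.labelSucc i) vQ ⊆
        (settingPrVolSharp X hlog M archPk archSub Ψ act Mmod region n lat sig split qData tq t htq0 htq1).thetaHull (Setting.labelSucc i) vQ)
    (hbudget : processionNormalized (fun i : Fin (thetaIndex X).lstar => ∑ᶠ vQ ∈ {vQ : (thetaIndex X).VQ | j₀ vQ < (i : ℕ) + 1},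
          ((((i : ℕ) + 1 : ℕ) : ℝ) ^ 2 - 1) *
            (-(settingPrVolSharp X hlog M archPk archSub Ψ act Mmod region n lat sig split qData tq t htq0 htq1).qLocal
              (Setting.labelSucc i) vQ)) ≤
      processionNormalized (fun i : Fin (thetaIndex X).lstar => ∑ᶠ vQ ∈ {vQ : (thetaIndex X).VQ | (i : ℕ) + 1 ≤ j₀ vQ},
          (((situationPrVol X hlog M archPk archSub Ψ act Mmod region).D n).logvol _ vQ
              ((settingPrVolSharp X hlog M archPk archSub Ψ act Mmod region n lat sig split qData tq t htq0 htq1).thetaHull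
                (Setting.labelSucc i) vQ) -
            (settingPrVolSharp X hlog M archPk archSub Ψ act Mmod region n lat sig split qData tq t htq0 htq1).qLocal
              (Setting.labelSucc i) vQ))) :
    (settingPrVolSharp X hlog M archPk archSub Ψ act Mmod region n lat sig split qData tq t htq0 htq1).Statement :=
  statement_settingPrVolSharp_of_licenceBelow_of_budget X hlog M archPk archSub Ψ act Mmod region n lat sig split qData t tq ht0 ht htq0
    htq1 j₀ hbelow
    ((aboveCut_deficit_le_floorMass_settingPrVolSharp X hlog M archPk archSub Ψ act Mmod region n lat sig split qData t tq ht0 ht htq0 htq1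
      htq j₀).trans hbudget)

include ht0 ht htq in
/-- **THE NUMBERS DOOR AT THE BED.** Finitely supported below-cut surplus bounds `s_{i,v_ℚ} ≤ σ_{i+1,v_ℚ}` (whatever their source: a licence cell
signs `s = 0`, a reach / hull-volume theorem a positive `s`) with «above-cut floor mass ≤ PN(below Σᶠ s)» give the typed Statement. NO licence and NO
I06⋆ hypothesis: the cells are only the SOURCE of the numbers. [claim: Mochizuki2012, status: disputed] -/
theorem statement_settingPrVolSharp_of_surplusBelow_ge_floorMass (s : Fin (thetaIndex X).lstar → (thetaIndex X).VQ → ℝ)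
    (hsfin : ∀ i : Fin (thetaIndex X).lstar, (Function.support (s i)).Finite)
    (hs : ∀ (i : Fin (thetaIndex X).lstar) (vQ : (thetaIndex X).VQ), (i : ℕ) + 1 ≤ j₀ vQ →
      s i vQ ≤ ((situationPrVol X hlog M archPk archSub Ψ act Mmod region).D n).logvol _ vQ
            ((settingPrVolSharp X hlog M archPk archSub Ψ act Mmod region n lat sig split qData tq t htq0 htq1).thetaHull
              (Setting.labelSucc i) vQ) -
          (settingPrVolSharp X hlog M archPk archSub Ψ act Mmod region n lat sig split qData tq t htq0 htq1).qLocal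
            (Setting.labelSucc i) vQ)
    (hbudget : processionNormalized (fun i : Fin (thetaIndex X).lstar => ∑ᶠ vQ ∈ {vQ : (thetaIndex X).VQ | j₀ vQ < (i : ℕ) + 1},
          ((((i : ℕ) + 1 : ℕ) : ℝ) ^ 2 - 1) *
            (-(settingPrVolSharp X hlog M archPk archSub Ψ act Mmod region n lat sig split qData tq t htq0 htq1).qLocal
              (Setting.labelSucc i) vQ)) ≤
      processionNormalized (fun i : Fin (thetaIndex X).lstar => ∑ᶠ vQ ∈ {vQ : (thetaIndex X).VQ | (i : ℕ) + 1 ≤ j₀ vQ}, s i vQ)) :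
    (settingPrVolSharp X hlog M archPk archSub Ψ act Mmod region n lat sig split qData tq t htq0 htq1).Statement := by
  have hfin := thetaFinite X hlog M archPk archSub Ψ act Mmod region n lat sig split qData t tq ht0 ht htq0 htq1
  rw [statement_settingPrVolSharp_iff_cut_budget X hlog M archPk archSub Ψ act Mmod region n lat sig split qData t tq ht0 ht htq0 htq1 j₀]
  -- below the cut: `PN(below Σᶠ s) ≤ PN(below Σᶠ σ)` (pointwise on the cut window, indicator bookkeeping)
  have hbelow : processionNormalized (fun i : Fin (thetaIndex X).lstar => ∑ᶠ vQ ∈ {vQ : (thetaIndex X).VQ | (i : ℕ) + 1 ≤ j₀ vQ}, s i vQ) ≤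
      processionNormalized (fun i : Fin (thetaIndex X).lstar => ∑ᶠ vQ ∈ {vQ : (thetaIndex X).VQ | (i : ℕ) + 1 ≤ j₀ vQ},
          (((situationPrVol X hlog M archPk archSub Ψ act Mmod region).D n).logvol _ vQ
              ((settingPrVolSharp X hlog M archPk archSub Ψ act Mmod region n lat sig split qData tq t htq0 htq1).thetaHull
                (Setting.labelSucc i) vQ) -
            (settingPrVolSharp X hlog M archPk archSub Ψ act Mmod region n lat sig split qData tq t htq0 htq1).qLocal
              (Setting.labelSucc i) vQ)) := by
    refine processionNormalized_mono fun i => ?_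
    have hf : (Function.support ({vQ : (thetaIndex X).VQ | (i : ℕ) + 1 ≤ j₀ vQ}.indicator (s i))).Finite := by
      rw [Set.support_indicator]; exact (hsfin i).inter_of_right _
    have hg : (Function.support ({vQ : (thetaIndex X).VQ | (i : ℕ) + 1 ≤ j₀ vQ}.indicator fun vQ : (thetaIndex X).VQ =>
        ((situationPrVol X hlog M archPk archSub Ψ act Mmod region).D n).logvol _ vQ
            ((settingPrVolSharp X hlog M archPk archSub Ψ act Mmod region n lat sig split qData tq t htq0 htq1).thetaHull
              (Setting.labelSucc i) vQ) -
          (settingPrVolSharp X hlog M archPk archSub Ψ act Mmod region n lat sig split qData tq t htq0 htq1).qLocal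
            (Setting.labelSucc i) vQ)).Finite := by
      rw [Set.support_indicator]
      exact (ObstructionSS28Window.cellSlack_support_finite
        (LatticeSituation.ofShells (logShellsDH X logv) M archPk archSub (summandPiecesPr X hlog).Adm (summandPiecesPr X hlog).logvol Ψ act
          Mmod region (fun _ _ => (summandPiecesPr X hlog).Adm) (fun _ _ => (summandPiecesPr X hlog).logvol) (fun k _ => Ψ k)
          (fun k _ => Mmod k) (fun _ _ _ _ _ => ∅) (fun _ _ _ _ => ∅) (fun _ _ _ => 0))
        (settingPrVolSharp X hlog M archPk archSub Ψ act Mmod region n lat sig split qData tq t htq0 htq1) hfin i).inter_of_right _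
    rw [finsum_mem_def, finsum_mem_def]
    refine finsum_le_finsum' hf hg fun vQ => ?_
    by_cases hW : (i : ℕ) + 1 ≤ j₀ vQ
    · have hm : vQ ∈ {vQ : (thetaIndex X).VQ | (i : ℕ) + 1 ≤ j₀ vQ} := hW
      simp only [Set.indicator_of_mem hm]
      exact hs i vQ hW
    · have hn : vQ ∉ {vQ : (thetaIndex X).VQ | (i : ℕ) + 1 ≤ j₀ vQ} := hW
      simp only [Set.indicator_of_notMem hn, le_refl]
  have habove := aboveCut_deficit_le_floorMass_settingPrVolSharp X hlog M archPk archSub Ψ act Mmod region n lat sig split qData t tq ht0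
    ht htq0 htq1 htq j₀
  linarith

end Cut

end Summit.ABC.IUTFork.Repair.RHLabelCutGenuine

end
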